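import Summits.Schanuel.Schanuel.Theorems.DiophantineDichotomyKhovanskiiApproxTypeSlotDichotomyTwo
import HarnessLib

/-!
# Stub `stub_linearFormCertificate` (line `Sketch`, sub-goal G, skeleton v12, lead c13)

Crux `DiophantineDichotomy.KhovanskiiApproxTypeEv` (stmt-Schanuel-14972).  The crux-strategist's first lemma
`linearFormCertificate_of : OrderDefectMeasure n κ → LinearFormCertificate n κ` of
`Cruxes/KhovanskiiApproxTypeEv/SketchIdea.lean` (idea `order-defect-certificates`, STRATEGY-CENSUS §7), with
both definitions unfolded.  Pure bookkeeping: at the Lindemann–Weierstrass point `θ = (s, e^s)` put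
`η = Σ_j e^{s_j}`; a challenger `γ` with `‖γ − θ‖ = δ ≤ 1` whose `y`-coordinates sum to a root `ϑ` of a
non-zero `P ∈ ℤ[x]` (`deg P ≤ D`, height `≤ H`) has `|η − ϑ| ≤ n δ`, so the mean value estimate
(`norm_aeval_sub_aeval_le`) gives `|P(η)| ≤ (D+1) H D R^D n δ` on the disc of radius `R = n (‖e^s‖ + 1) + 1`,
while the order-defect measure gives `|P(η)| ≥ exp(−C D^κ log H)` for `H ≥ H₀(D)`; the factor `D R^D` is
absorbed by raising `C` to `C + 1` and the (degree-dependent) threshold.  Everything here is proved; no named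
facts.
-/

noncomputable section

set_option linter.dupNamespace false -- mandated summit/sub-problem namespace

namespace Summit.Schanuel.Schanuel.Cruxes.KhovanskiiApproxTypeEv.AnchoredReduction

open Summit.Schanuel.Schanuel.Cruxes.KhovanskiiApproxType.LwSmallHeight (norm_aeval_sub_aeval_le)
open Polynomial

/-- Threshold absorption: for `D ≥ 1`, `R ≥ 1`, `t > 0` and `H ≥ exp(log(D R^D) / t)` one has
`D R^D exp(−t log H) ≤ 1`. -/
theorem natCast_mul_pow_mul_exp_neg_le_one {D H : ℕ} {R t : ℝ} (hD : 0 < D) (hR : 1 ≤ R)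
    (ht : 0 < t) (hH : ⌈Real.exp (Real.log (D * R ^ D) / t)⌉₊ ≤ H) :
    (D : ℝ) * R ^ D * Real.exp (-(t * Real.log H)) ≤ 1 := by
  have hD' : (0 : ℝ) < D := by exact_mod_cast hD
  have hDR : (0 : ℝ) < D * R ^ D := mul_pos hD' (pow_pos (one_pos.trans_le hR) D)
  have hHr : Real.exp (Real.log (D * R ^ D) / t) ≤ H :=
    (Nat.le_ceil _).trans (by exact_mod_cast hH)
  have hHpos : (0 : ℝ) < H := (Real.exp_pos _).trans_le hHr
  have hlog : Real.log (D * R ^ D) / t ≤ Real.log H := by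
    rw [Real.le_log_iff_exp_le hHpos]; exact hHr
  rw [div_le_iff₀ ht] at hlog
  calc (D : ℝ) * R ^ D * Real.exp (-(t * Real.log H))
      = Real.exp (Real.log (D * R ^ D) + -(t * Real.log H)) := by
        rw [Real.exp_add, Real.exp_log hDR]
    _ ≤ Real.exp 0 := Real.exp_le_exp.2 (by nlinarith)
    _ = 1 := Real.exp_zero

/-- Coordinatewise control at `θ = (s, e^s)`: each `y`-coordinate of a challenger `γ` is within `‖γ − θ‖` of
`e^{s_j}`. -/
theorem norm_exp_sub_inr_le {n : ℕ} (s : Fin n → ℂ) (γ : Fin n ⊕ Fin n → ℂ) (j : Fin n) :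
    ‖Complex.exp (s j) - γ (Sum.inr j)‖ ≤ ‖γ - Sum.elim s (Complex.exp ∘ s)‖ := by
  have h := norm_le_pi_norm (γ - Sum.elim s (Complex.exp ∘ s)) (Sum.inr j)
  rw [Pi.sub_apply, Sum.elim_inr, Function.comp_apply] at h
  rwa [norm_sub_rev]

/-- `|η − ϑ| ≤ n ‖γ − θ‖` for `η = Σ_j e^{s_j}` and `ϑ = Σ_j γ(y_j)`. -/
theorem norm_sum_exp_sub_sum_inr_le {n : ℕ} (s : Fin n → ℂ) (γ : Fin n ⊕ Fin n → ℂ) :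
    ‖∑ j, Complex.exp (s j) - ∑ j, γ (Sum.inr j)‖ ≤ n * ‖γ - Sum.elim s (Complex.exp ∘ s)‖ := by
  rw [← Finset.sum_sub_distrib]
  calc ‖∑ j, (Complex.exp (s j) - γ (Sum.inr j))‖
      ≤ ∑ j, ‖Complex.exp (s j) - γ (Sum.inr j)‖ := norm_sum_le _ _
    _ ≤ ∑ _j : Fin n, ‖γ - Sum.elim s (Complex.exp ∘ s)‖ :=
        Finset.sum_le_sum fun j _ => norm_exp_sub_inr_le s γ j
    _ = n * ‖γ - Sum.elim s (Complex.exp ∘ s)‖ := by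
        rw [Finset.sum_const, Finset.card_univ, Fintype.card_fin, nsmul_eq_mul]

/-- `|η| ≤ n ‖e^s‖` for `η = Σ_j e^{s_j}` (sup norm on `Fin n → ℂ`). -/
theorem norm_sum_exp_le {n : ℕ} (s : Fin n → ℂ) :
    ‖∑ j, Complex.exp (s j)‖ ≤ n * ‖Complex.exp ∘ s‖ := by
  calc ‖∑ j, Complex.exp (s j)‖ ≤ ∑ j, ‖Complex.exp (s j)‖ := norm_sum_le _ _
    _ ≤ ∑ _j : Fin n, ‖Complex.exp ∘ s‖ :=
        Finset.sum_le_sum fun j _ => norm_le_pi_norm (Complex.exp ∘ s) j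
    _ = n * ‖Complex.exp ∘ s‖ := by
        rw [Finset.sum_const, Finset.card_univ, Fintype.card_fin, nsmul_eq_mul]

/-- `|ϑ| ≤ n (‖e^s‖ + ‖γ − θ‖)` for `ϑ = Σ_j γ(y_j)`. -/
theorem norm_sum_inr_le {n : ℕ} (s : Fin n → ℂ) (γ : Fin n ⊕ Fin n → ℂ) :
    ‖∑ j, γ (Sum.inr j)‖ ≤ n * (‖Complex.exp ∘ s‖ + ‖γ - Sum.elim s (Complex.exp ∘ s)‖) := by
  calc ‖∑ j, γ (Sum.inr j)‖ ≤ ∑ j, ‖γ (Sum.inr j)‖ := norm_sum_le _ _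
    _ ≤ ∑ _j : Fin n, (‖Complex.exp ∘ s‖ + ‖γ - Sum.elim s (Complex.exp ∘ s)‖) :=
        Finset.sum_le_sum fun j _ => by
          have h1 := norm_le_pi_norm (Complex.exp ∘ s) j
          have h2 := norm_exp_sub_inr_le s γ j
          have h3 := norm_sub_norm_le (γ (Sum.inr j)) (Complex.exp (s j))
          rw [Function.comp_apply] at h1
          rw [norm_sub_rev] at h2
          linarith
    _ = n * (‖Complex.exp ∘ s‖ + ‖γ - Sum.elim s (Complex.exp ∘ s)‖) := by
        rw [Finset.sum_const, Finset.card_univ, Fintype.card_fin, nsmul_eq_mul]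

/-- SUB-GOAL G of line `Sketch` (skeleton v12, lead c13): the crux-strategist's first lemma
`linearFormCertificate_of : OrderDefectMeasure n κ → LinearFormCertificate n κ` of
`Cruxes/KhovanskiiApproxTypeEv/SketchIdea.lean` (idea `order-defect-certificates`, STRATEGY-CENSUS §7), with both
definitions UNFOLDED: an order-defect measure for η = Σ e^{s_j} repels, at the Lindemann–Weierstrass point
θ = (s, e^s), every challenger whose y-coordinates sum exactly to a root of a non-zero integer polynomial of
degree ≤ D and height ≤ H. -/
theorem stub_linearFormCertificate (n : ℕ) (κ : ℝ)
    (hM2 : ∀ β : Fin n → ℂ, (∀ j, IsAlgebraic ℚ (β j)) → LinearIndependent ℚ β →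
      ∃ C : ℝ, 0 < C ∧ ∀ D : ℕ, ∃ H₀ : ℕ, ∀ (H : ℕ) (P : Polynomial ℤ), H₀ ≤ H → P ≠ 0 →
        P.natDegree ≤ D → (∀ k, |P.coeff k| ≤ (H : ℤ)) →
          Real.exp (-(C * (D : ℝ) ^ κ * Real.log H)) ≤ ‖Polynomial.aeval (∑ j, Complex.exp (β j)) P‖)
    (s : Fin n → ℂ) (halg : ∀ j, IsAlgebraic ℚ (s j)) (hli : LinearIndependent ℚ s) :
    ∃ C : ℝ, 0 < C ∧ ∀ D : ℕ, ∃ H₀ : ℕ, ∀ (H : ℕ) (γ : Fin n ⊕ Fin n → ℂ) (P : Polynomial ℤ),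
      H₀ ≤ H → P ≠ 0 → P.natDegree ≤ D → (∀ k, |P.coeff k| ≤ (H : ℤ)) →
      Polynomial.aeval (∑ j, γ (Sum.inr j)) P = 0 → ‖γ - Sum.elim s (Complex.exp ∘ s)‖ ≤ 1 →
        Real.exp (-(C * (D : ℝ) ^ κ * Real.log H)) /
            (n * (D + 1) * H * (2 + ‖Complex.exp ∘ s‖) ^ D)
          ≤ ‖γ - Sum.elim s (Complex.exp ∘ s)‖ := by
  obtain ⟨C, hC, hall⟩ := hM2 s halg hli
  refine ⟨C + 1, by linarith, fun D => ?_⟩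
  obtain ⟨H₀, hH₀⟩ := hall D
  -- the radius of the disc carrying `η` and `ϑ`
  set E : ℝ := ‖Complex.exp ∘ s‖ with hE
  set R : ℝ := n * (E + 1) + 1 with hR
  have hE0 : 0 ≤ E := norm_nonneg _
  have hn0 : (0 : ℝ) ≤ n := Nat.cast_nonneg n
  have hR1 : 1 ≤ R := by rw [hR]; nlinarith
  refine ⟨max (max H₀ 2) ⌈Real.exp (Real.log (D * R ^ D) / (D : ℝ) ^ κ)⌉₊,
    fun H γ P hH hP0 hPdeg hPH hroot hclose => ?_⟩
  have hHH₀ : H₀ ≤ H := le_trans (le_trans (le_max_left _ _) (le_max_left _ _)) hH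
  have hH2 : 2 ≤ H := le_trans (le_trans (le_max_right _ _) (le_max_left _ _)) hH
  have hHc : ⌈Real.exp (Real.log (D * R ^ D) / (D : ℝ) ^ κ)⌉₊ ≤ H := le_trans (le_max_right _ _) hH
  set δ : ℝ := ‖γ - Sum.elim s (Complex.exp ∘ s)‖ with hδ
  have hδ0 : 0 ≤ δ := norm_nonneg _
  -- `η`, `ϑ` lie in the disc of radius `R`, at distance `≤ n δ`
  have hηϑ : ‖∑ j, Complex.exp (s j) - ∑ j, γ (Sum.inr j)‖ ≤ n * δ :=
    norm_sum_exp_sub_sum_inr_le s γ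
  have hηR : ‖∑ j, Complex.exp (s j)‖ ≤ R :=
    (norm_sum_exp_le s).trans (by rw [hR]; nlinarith)
  have hϑR : ‖∑ j, γ (Sum.inr j)‖ ≤ R := by
    refine (norm_sum_inr_le s γ).trans ?_
    rw [hR]
    nlinarith [mul_le_mul_of_nonneg_left hclose hn0]
  -- mean value estimate and the order-defect measure
  have hB : ∀ k, |(P.coeff k : ℝ)| ≤ (H : ℝ) := fun k => by exact_mod_cast hPH k
  have hmv := norm_aeval_sub_aeval_le P hR1 hηR hϑR hB hPdeg
  rw [hroot, sub_zero] at hmv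
  have hup : ‖aeval (∑ j, Complex.exp (s j)) P‖ ≤
      ((D : ℝ) + 1) * (H * (D * R ^ D)) * (n * δ) :=
    hmv.trans (mul_le_mul_of_nonneg_left hηϑ (by positivity))
  have hlow := hH₀ H P hHH₀ hP0 hPdeg hPH
  -- absorption of `D R^D` by the surplus `exp(−D^κ log H)`
  have key : (D : ℝ) * R ^ D * Real.exp (-((D : ℝ) ^ κ * Real.log H)) ≤ 1 := by
    rcases Nat.eq_zero_or_pos D with hD | hD
    · rw [hD, Nat.cast_zero, zero_mul, zero_mul]; exact zero_le_one
    · exact natCast_mul_pow_mul_exp_neg_le_one hD hR1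
        (Real.rpow_pos_of_pos (by exact_mod_cast hD) κ) hHc
  have hmain : Real.exp (-((C + 1) * (D : ℝ) ^ κ * Real.log H)) ≤
      δ * (n * (D + 1) * H * (2 + E) ^ D) := by
    have hsplit : Real.exp (-((C + 1) * (D : ℝ) ^ κ * Real.log H)) =
        Real.exp (-(C * (D : ℝ) ^ κ * Real.log H)) * Real.exp (-((D : ℝ) ^ κ * Real.log H)) := by
      rw [← Real.exp_add]; congr 1; ring
    have hfac : 0 ≤ ((D : ℝ) + 1) * H * (n * δ) := by positivity
    have h2E : 1 ≤ (2 + E) ^ D := one_le_pow₀ (by linarith)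
    rw [hsplit]
    calc Real.exp (-(C * (D : ℝ) ^ κ * Real.log H)) * Real.exp (-((D : ℝ) ^ κ * Real.log H))
        ≤ ((D : ℝ) + 1) * (H * (D * R ^ D)) * (n * δ) * Real.exp (-((D : ℝ) ^ κ * Real.log H)) :=
          mul_le_mul_of_nonneg_right (hlow.trans hup) (Real.exp_pos _).le
      _ = ((D : ℝ) + 1) * H * (n * δ) *
            ((D : ℝ) * R ^ D * Real.exp (-((D : ℝ) ^ κ * Real.log H))) := by ring
      _ ≤ ((D : ℝ) + 1) * H * (n * δ) * 1 := mul_le_mul_of_nonneg_left key hfac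
      _ ≤ ((D : ℝ) + 1) * H * (n * δ) * (2 + E) ^ D := mul_le_mul_of_nonneg_left h2E hfac
      _ = δ * (n * (D + 1) * H * (2 + E) ^ D) := by ring
  exact div_le_of_le_mul₀ (by positivity) hδ0 hmain

end Summit.Schanuel.Schanuel.Cruxes.KhovanskiiApproxTypeEv.AnchoredReduction

end
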